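import Literature.AlgebraicTopology.SingularHomology.OnePointCollapse
import Literature.AlgebraicTopology.SingularHomology.FundamentalClassExistence
import Literature.AlgebraicTopology.SingularHomology.SubsetCochainsComparisonPull
import Literature.AlgebraicTopology.SingularHomology.UniversalCoefficientsField

/-!
# Route AmpleAdicLefschetz — `AlgebraicClassesHodgeType`, part 2: a bump class near one smooth
# point of the image of a resolution

Helper file for item stmt-HodgeConjecture-15189 (`AlgebraicClassesHodgeType`), purely
topological.  Setting (abstracted from: `M = X(ℂ)`, `N = Ỹ(ℂ)` for a resolution `Ỹ → V ⊆ X` of an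
irreducible subvariety, `T = V(ℂ)`, `e` a GAGA straightening chart of `V(ℂ)` at a smooth point `b`
over which the resolution is an isomorphism): `M` Hausdorff, `N` a closed `ℂ`-oriented topological
`k`-manifold, `f : N → M` continuous with image in `T ⊆ M`, `T` straightened near `b ∈ T` by a
chart `e : M ⇀ F × K` (`T ∩ e.source = {e(·).1 = 0}`), and over an open `O ∋ b` the map `f`
restricts to a homeomorphism from `N₁ = f⁻¹(O)` onto `T ∩ O`.  Conclusion
(`exists_bump_class`): an open `W₁ ⊇ T` and a class `η ∈ Hᵏ(W₁; ℂ)` whose pull-back along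
`f : N → W₁` is non-zero.  This is the non-vanishing input of the top-degree case of Deligne's
Prop. 8.2.7 for one irreducible subvariety (part 3): the pull-back `Ȟ^{2d}(V(ℂ)) → H^{2d}(Ỹ(ℂ))` is
not zero.

Construction (Pontryagin–Thom collapse, Milnor 1965 §7; no smooth structure needed): remove from
`M` the compact collar `Σ = e⁻¹((B̄_F(ε) ∖ B_F(ε/2)) × B̄_K(v₀, δ))`, which misses `T`; on
`W₁ = M ∖ Σ` let `Φ : W₁ → K⁺ = OnePoint K` be the `K`-coordinate of `e`, collapsed outside the ball
`B_K(v₀, δ)`, on the thin box `{‖e(·).1‖ < ε/2}`, and `∞` elsewhere — continuous because off the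
compact box `e⁻¹(B̄_F(ε/2) × B̄_K(v₀, δ))` both descriptions give `∞`; then `Φ ∘ f` is the collapse
of `N` onto `K⁺` along the ball `f⁻¹ e⁻¹({0} × B_K(v₀, δ))` around `a = f⁻¹(b)`
(`OnePoint.collapseCM`), an isomorphism on local homology at `a`
(`OnePoint.isIso_map_collapse_local`), so `(Φ ∘ f)_* [N] ≠ 0` (its localisation is the image of
the local orientation, `isFundamentalClass_fundamentalClass_holds`), some `ω ∈ Hᵏ(K⁺; ℂ)` has
`(Φ ∘ f)^* ω ≠ 0` (universal coefficients over `ℂ`, `kroneckerPairing_bijective_of_field`), and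
`η = Φ^* ω`.  Everything here is proved; no definitions, no named facts.
-/

set_option linter.dupNamespace false

noncomputable section

open scoped OnePoint
open CategoryTheory CategoryTheory.Limits Set TopologicalSpace Metric Filter Topology
open Literature.AlgebraicTopology.SingularHomology

namespace Summit.HodgeConjecture.HodgeConjecture.Theorems

/-- **A bump class near one straightened point of the image.** Topological setting: `M` Hausdorff,
`N` a closed `ℂ`-oriented topological `k`-manifold, `f : N → M` continuous with image in a subset
`T ⊆ M`; `T` is straightened near a point `b ∈ T` by a chart `e : M ⇀ F × K` (`T = {e(·).1 = 0}` on
`e.source`); and over an open `O ∋ b` of `M` the map `f` is a homeomorphism from an open `N₁ ⊆ N`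
onto `T ∩ O`. Then there are an open `W₁ ⊇ T` and a class `η ∈ Hᵏ(W₁; ℂ)` with `f^* η ≠ 0` in
`Hᵏ(N; ℂ)` (stated for the restriction `↥univ → ↥W₁` of `f`). Construction: remove from `M` the
compact collar `Sg = e⁻¹((B̄_F(ε) ∖ B_F(ε/2)) × B̄_K(v₀, δ))` (disjoint from `T`), and let
`Φ : M ∖ Sg → K⁺ = OnePoint K` be the `K`-coordinate collapsed outside the ball `B_K(v₀, δ)` on the
thin box `{‖e(·).1‖ < ε/2}` and `∞` elsewhere (continuous: the two descriptions agree on an open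
cover); `Φ ∘ f` is the collapse of `N` onto `K⁺` along a ball around `a = f⁻¹(b)`, which is an
isomorphism on local homology (`OnePoint.isIso_map_collapse_local`), so `(Φ ∘ f)_* [N] ≠ 0`
(its localisation at `a` is the local orientation) and some `ω ∈ Hᵏ(K⁺; ℂ)` has
`(Φ ∘ f)^* ω ≠ 0` (universal coefficients over `ℂ`); `η = Φ^* ω`.
[cite: MilnorTDV1965, §7] [cite: HatcherAT2002, §3.3 Thm. 3.26 and §3.1 Thm. 3.2] -/
theorem exists_bump_class {M N F K : Type} [TopologicalSpace M] [T2Space M] [TopologicalSpace N]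
    [CompactSpace N] [T2Space N] {k : ℕ} [ChartedSpace (EuclideanSpace ℝ (Fin k)) N]
    (ν : HomologicalOrientation ℂ N k)
    [NormedAddCommGroup F] [NormedSpace ℝ F] [FiniteDimensional ℝ F]
    [NormedAddCommGroup K] [NormedSpace ℝ K] [FiniteDimensional ℝ K]
    (f : C(N, M)) (T : Set M) (hfT : ∀ z, f z ∈ T)
    (e : OpenPartialHomeomorph M (F × K)) (he : ∀ Q ∈ e.source, Q ∈ T ↔ (e Q).1 = 0)
    (O : Set M) (hO : IsOpen O) (N₁ : Set N)
    (hemb : IsEmbedding (fun z : ↥N₁ ↦ f z)) (hrange : f '' N₁ = T ∩ O)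
    (hfib : ∀ z, f z ∈ O → z ∈ N₁)
    (b : M) (hbT : b ∈ T) (hbO : b ∈ O) (hbe : b ∈ e.source) :
    ∃ W₁ : Set M, IsOpen W₁ ∧ T ⊆ W₁ ∧ ∃ (hW : MapsTo f univ W₁)
      (η : singularCohomology ℂ ℂ ↥W₁ k),
      singularCohomology.map ℂ ℂ (subsetCochains.restrictMap f hW) k η ≠ 0 := by
  -- coordinates of `b`: `e b = (0, v₀)`
  set v₀ : K := (e b).2 with hv₀
  have heb : e b = (0, v₀) := Prod.ext ((he b hbe).1 hbT) rfl
  have hbt : ((0 : F), v₀) ∈ e.target := heb ▸ e.map_source hbe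
  -- the good `K`-directions: `(0, v) ∈ e.target` and `e⁻¹(0, v) ∈ O`
  set D : Set K := {v | ((0 : F), v) ∈ e.target ∧ e.symm ((0 : F), v) ∈ O} with hD
  have hDo : IsOpen D := by
    have h1 : IsOpen {v : K | ((0 : F), v) ∈ e.target} :=
      e.open_target.preimage (Continuous.prodMk_right 0)
    have h2 : ContinuousOn (fun v : K ↦ e.symm ((0 : F), v)) {v : K | ((0 : F), v) ∈ e.target} :=
      e.continuousOn_symm.comp (Continuous.prodMk_right 0).continuousOn fun v hv ↦ hv
    exact h2.isOpen_inter_preimage h1 hO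
  have hv₀D : v₀ ∈ D := by
    refine ⟨hbt, ?_⟩
    rw [← heb, e.left_inv hbe]
    exact hbO
  -- radii: `closedBall 0 ε ×ˢ closedBall v₀ δ ⊆ e.target` and `closedBall v₀ δ ⊆ D`
  obtain ⟨ρ, hρ, hρt⟩ := Metric.isOpen_iff.1 e.open_target _ hbt
  obtain ⟨δ₁, hδ₁, hδ₁D⟩ := Metric.isOpen_iff.1 hDo _ hv₀D
  set ε : ℝ := ρ / 2 with hε
  set δ : ℝ := min (ρ / 2) (δ₁ / 2) with hδ
  have hε0 : 0 < ε := by positivity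
  have hδ0 : 0 < δ := by positivity
  have hbox : closedBall (0 : F) ε ×ˢ closedBall v₀ δ ⊆ e.target := by
    rintro ⟨u, v⟩ ⟨hu, hv⟩
    refine hρt ?_
    rw [mem_closedBall] at hu hv
    rw [mem_ball, Prod.dist_eq, max_lt_iff]
    constructor
    · calc dist u 0 ≤ ε := hu
        _ < ρ := by rw [hε]; linarith
    · calc dist v v₀ ≤ δ := hv
        _ ≤ ρ / 2 := min_le_left _ _
        _ < ρ := by linarith
  have hballD : closedBall v₀ δ ⊆ D := fun v hv ↦ hδ₁D (by
    rw [mem_closedBall] at hv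
    rw [mem_ball]
    calc dist v v₀ ≤ δ := hv
      _ ≤ δ₁ / 2 := min_le_right _ _
      _ < δ₁ := by linarith)
  -- the compact collar `Sg` and the open set `W₁ = M ∖ Sg`
  set A : Set (F × K) := (closedBall (0 : F) ε \ ball (0 : F) (ε / 2)) ×ˢ closedBall v₀ δ with hA
  have hAc : IsCompact A :=
    ((isCompact_closedBall _ _).diff isOpen_ball).prod (isCompact_closedBall _ _)
  have hAt : A ⊆ e.target := fun x hx ↦ hbox ⟨hx.1.1, hx.2⟩
  set Sg : Set M := e.symm '' A with hSg
  have hSgc : IsCompact Sg := hAc.image_of_continuousOn (e.continuousOn_symm.mono hAt)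
  set W₁ : Set M := Sgᶜ with hW₁def
  have hW₁ : IsOpen W₁ := hSgc.isClosed.isOpen_compl
  have hSgmem : ∀ Q ∈ Sg, Q ∈ e.source ∧ e Q ∈ A := by
    rintro _ ⟨x, hx, rfl⟩
    exact ⟨e.map_target (hAt hx), by rw [e.right_inv (hAt hx)]; exact hx⟩
  have hTW₁ : T ⊆ W₁ := by
    intro Q hQT hQSg
    obtain ⟨hQs, hQA⟩ := hSgmem Q hQSg
    have h0 : (e Q).1 = 0 := (he Q hQs).1 hQT
    apply hQA.1.2
    rw [h0, mem_ball, dist_self]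
    positivity
  have hfW : MapsTo f univ W₁ := fun z _ ↦ hTW₁ (hfT z)
  -- the homeomorphism `ball v₀ δ ≃ₜ K` and the collapse `CK : K → K⁺` of its complement
  let hK : ↥(ball v₀ δ) ≃ₜ K :=
    ((Homeomorph.setCongr (OpenPartialHomeomorph.univBall_target v₀ hδ0)).symm.trans
      (OpenPartialHomeomorph.univBall v₀ δ).toHomeomorphSourceTarget.symm).trans
      ((Homeomorph.setCongr (OpenPartialHomeomorph.univBall_source v₀ δ)).trans
        (Homeomorph.Set.univ K))
  let CK : C(K, OnePoint K) := OnePoint.collapseCM isOpen_ball hK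
  -- the thin box `O₁`, the compact box `C`, and `Φ : W₁ → K⁺`
  set O₁ : Set M := e.source ∩ e ⁻¹' (ball (0 : F) (ε / 2) ×ˢ (univ : Set K)) with hO₁
  have hO₁o : IsOpen O₁ := e.isOpen_inter_preimage (isOpen_ball.prod isOpen_univ)
  have hCsub : closedBall (0 : F) (ε / 2) ×ˢ closedBall v₀ δ ⊆ e.target := fun x hx ↦
    hbox ⟨closedBall_subset_closedBall (by linarith) hx.1, hx.2⟩
  set C : Set M := e.symm '' (closedBall (0 : F) (ε / 2) ×ˢ closedBall v₀ δ) with hC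
  have hCc : IsCompact C :=
    ((isCompact_closedBall _ _).prod (isCompact_closedBall _ _)).image_of_continuousOn
      (e.continuousOn_symm.mono hCsub)
  classical
  let Φ : ↥W₁ → OnePoint K := fun Q ↦ if Q.1 ∈ O₁ then CK (e Q.1).2 else ∞
  -- a point of `W₁` outside `O₁` is outside `C`, and `Φ = ∞` off `C`
  have hcov : ∀ Q : ↥W₁, Q.1 ∉ O₁ → Q.1 ∉ C := by
    intro Q hQO hQC
    obtain ⟨x, hx, hxQ⟩ := hQC
    have hQs : Q.1 ∈ e.source := hxQ ▸ e.map_target (hCsub hx)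
    have heQ : e Q.1 = x := by rw [← hxQ, e.right_inv (hCsub hx)]
    have hx1 : x.1 ∉ ball (0 : F) (ε / 2) := fun h ↦
      hQO ⟨hQs, by rw [mem_preimage, heQ]; exact ⟨h, mem_univ _⟩⟩
    exact Q.2 ⟨x, ⟨⟨closedBall_subset_closedBall (by linarith) hx.1, hx1⟩, hx.2⟩, hxQ⟩
  have hΦinf : ∀ Q : ↥W₁, Q.1 ∉ C → Φ Q = ∞ := by
    intro Q hQC
    by_cases hQO : Q.1 ∈ O₁
    · simp only [Φ, if_pos hQO]
      apply OnePoint.collapse_apply_of_not_mem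
      intro hv
      apply hQC
      exact ⟨e Q.1, ⟨ball_subset_closedBall hQO.2.1, ball_subset_closedBall hv⟩, e.left_inv hQO.1⟩
    · simp only [Φ, if_neg hQO]
  have hΦcont : Continuous Φ := by
    rw [continuous_iff_continuousAt]
    intro Q
    by_cases hQO : Q.1 ∈ O₁
    · have hopen : IsOpen ((Subtype.val : ↥W₁ → M) ⁻¹' O₁) :=
        hO₁o.preimage continuous_subtype_val
      have hcontOn : ContinuousOn Φ ((Subtype.val : ↥W₁ → M) ⁻¹' O₁) := by
        have h1 : ContinuousOn (fun Q : ↥W₁ ↦ CK (e Q.1).2) ((Subtype.val : ↥W₁ → M) ⁻¹' O₁) := by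
          refine CK.continuous.comp_continuousOn (continuous_snd.comp_continuousOn ?_)
          exact e.continuousOn.comp continuous_subtype_val.continuousOn fun Q hQ ↦ hQ.1
        exact h1.congr fun Q hQ ↦ by simp only [Φ, if_pos (show Q.1 ∈ O₁ from hQ)]
      exact hcontOn.continuousAt (hopen.mem_nhds hQO)
    · have hopen : IsOpen ((Subtype.val : ↥W₁ → M) ⁻¹' Cᶜ) :=
        hCc.isClosed.isOpen_compl.preimage continuous_subtype_val
      have hev : Φ =ᶠ[𝓝 Q] fun _ ↦ ∞ := by
        filter_upwards [hopen.mem_nhds (hcov Q hQO)] with Q' hQ'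
        exact hΦinf Q' hQ'
      exact continuousAt_const.congr hev.symm
  let Φc : C(↥W₁, OnePoint K) := ⟨Φ, hΦcont⟩
  -- the collapse on `N`: `G = {z | f z ∈ e.source, (e (f z)).2 ∈ ball v₀ δ}`
  set G : Set N := {z | f z ∈ e.source ∧ (e (f z)).2 ∈ ball v₀ δ} with hG
  have hGo : IsOpen G := by
    have h1 : IsOpen {z : N | f z ∈ e.source} := e.open_source.preimage f.continuous
    have h2 : ContinuousOn (fun z : N ↦ (e (f z)).2) {z : N | f z ∈ e.source} :=
      continuous_snd.comp_continuousOn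
        (e.continuousOn.comp f.continuous.continuousOn fun z hz ↦ hz)
    exact h2.isOpen_inter_preimage h1 isOpen_ball
  have hesymm : ∀ z ∈ G, e.symm ((0 : F), (e (f z)).2) = f z := by
    intro z hz
    have h0 : (e (f z)).1 = 0 := (he _ hz.1).1 (hfT z)
    rw [← h0, Prod.mk.eta, e.left_inv hz.1]
  have hGO : ∀ z ∈ G, f z ∈ O := by
    intro z hz
    rw [← hesymm z hz]
    exact (hballD (ball_subset_closedBall hz.2)).2
  have hGN₁ : ∀ z ∈ G, z ∈ N₁ := fun z hz ↦ hfib z (hGO z hz)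
  -- the homeomorphism `N₁ ≃ₜ T ∩ O`
  have hrange' : range (fun z : ↥N₁ ↦ f z) = T ∩ O := by rw [← hrange, image_eq_range]
  let h₁ := hemb.toHomeomorph
  have h₁apply : ∀ z : ↥N₁, (h₁ z).1 = f z := fun z ↦ rfl
  -- good points of `K` give points of `T ∩ O`
  have hgood : ∀ v ∈ ball v₀ δ, e.symm ((0 : F), v) ∈ range (fun z : ↥N₁ ↦ f z) := by
    intro v hv
    have hvD := hballD (ball_subset_closedBall hv)
    rw [hrange']
    refine ⟨(he _ (e.map_target hvD.1)).2 ?_, hvD.2⟩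
    rw [e.right_inv hvD.1]
  let ψinv : ↥(ball v₀ δ) → N := fun v ↦ (h₁.symm ⟨e.symm ((0 : F), v.1), hgood v.1 v.2⟩).1
  have hψinv_f : ∀ v : ↥(ball v₀ δ), f (ψinv v) = e.symm ((0 : F), v.1) := by
    intro v
    have h := congrArg Subtype.val (h₁.apply_symm_apply ⟨e.symm ((0 : F), v.1), hgood v.1 v.2⟩)
    exact h
  have hψinv_mem : ∀ v : ↥(ball v₀ δ), ψinv v ∈ G := by
    intro v
    have hvD := hballD (ball_subset_closedBall v.2)
    refine ⟨?_, ?_⟩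
    · rw [hψinv_f]; exact e.map_target hvD.1
    · rw [hψinv_f, e.right_inv hvD.1]; exact v.2
  let ψ : ↥G ≃ₜ ↥(ball v₀ δ) :=
    { toFun := fun z ↦ ⟨(e (f z.1)).2, z.2.2⟩
      invFun := fun v ↦ ⟨ψinv v, hψinv_mem v⟩
      left_inv := by
        rintro ⟨z, hz⟩
        apply Subtype.ext
        change (h₁.symm ⟨e.symm ((0 : F), (e (f z)).2), _⟩).1 = z
        have hz' : h₁.symm ⟨e.symm ((0 : F), (e (f z)).2), hgood _ hz.2⟩ = ⟨z, hGN₁ z hz⟩ := by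
          rw [Homeomorph.symm_apply_eq]
          apply Subtype.ext
          change e.symm ((0 : F), (e (f z)).2) = f z
          exact hesymm z hz
        rw [hz']
      right_inv := by
        rintro ⟨v, hv⟩
        apply Subtype.ext
        change (e (f (ψinv ⟨v, hv⟩))).2 = v
        rw [hψinv_f, e.right_inv (hballD (ball_subset_closedBall hv)).1]
      continuous_toFun := by
        refine Continuous.subtype_mk ?_ _
        exact continuous_snd.comp
          (e.continuousOn.comp_continuous (f.continuous.comp continuous_subtype_val) fun z ↦ z.2.1)
      continuous_invFun := by
        refine Continuous.subtype_mk ?_ _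
        refine continuous_subtype_val.comp (h₁.symm.continuous.comp ?_)
        refine Continuous.subtype_mk ?_ _
        exact e.continuousOn_symm.comp_continuous ((Continuous.prodMk_right 0).comp continuous_subtype_val)
          fun v ↦ (hballD (ball_subset_closedBall v.2)).1 }
  let φN : ↥G ≃ₜ K := ψ.trans hK
  -- `Φ ∘ f` is the collapse of `N` along `G`
  let fW : C(N, ↥W₁) := ⟨fun z ↦ ⟨f z, hfW (mem_univ z)⟩, by fun_prop⟩
  set c : C(N, OnePoint K) := OnePoint.collapseCM hGo φN with hc
  have hcomp : Φc.comp fW = c := by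
    ext z
    change Φ ⟨f z, _⟩ = OnePoint.collapse G φN z
    by_cases hz : z ∈ G
    · have hzO : f z ∈ O₁ := by
        refine ⟨hz.1, ?_⟩
        rw [mem_preimage]
        refine ⟨?_, mem_univ _⟩
        rw [(he _ hz.1).1 (hfT z), mem_ball, dist_self]
        positivity
      rw [OnePoint.collapse_apply_of_mem G φN hz]
      simp only [Φ, if_pos hzO]
      change OnePoint.collapse (ball v₀ δ) hK (e (f z)).2 = _
      rw [OnePoint.collapse_apply_of_mem (ball v₀ δ) hK hz.2]
      rfl
    · rw [OnePoint.collapse_apply_of_not_mem G φN hz]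
      by_cases hzO : f z ∈ O₁
      · simp only [Φ, if_pos hzO]
        change OnePoint.collapse (ball v₀ δ) hK (e (f z)).2 = _
        exact OnePoint.collapse_apply_of_not_mem (ball v₀ δ) hK fun hv ↦ hz ⟨hzO.1, hv⟩
      · simp only [Φ, if_neg hzO]
  -- a point of `G` over `b`, and the local homology isomorphism of the collapse there
  obtain ⟨z₀, -, hz₀⟩ : b ∈ f '' N₁ := by rw [hrange]; exact ⟨hbT, hbO⟩
  have hz₀G : z₀ ∈ G := ⟨hz₀ ▸ hbe, by rw [hz₀, heb]; exact mem_ball_self hδ0⟩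
  haveI hiso := OnePoint.isIso_map_collapse_local ℂ ℂ hGo φN ⟨z₀, hz₀G⟩ k
  -- `c_* [N] ≠ 0`: its localisation at `z₀` is the image of the local orientation `ν_{z₀} ≠ 0`
  have hloc : singularHomology.toLocal ℂ ℂ z₀ k ν.fundamentalClass = ν.localClass z₀ :=
    HomologicalOrientation.isFundamentalClass_fundamentalClass_holds k ν z₀
  have hne0 : ν.localClass z₀ ≠ 0 := by
    obtain ⟨l, hl⟩ := ν.isGenerator z₀
    intro h0
    rw [h0, map_zero] at hl
    exact zero_ne_one hl
  have hpush : singularHomology.map ℂ ℂ c k ν.fundamentalClass ≠ 0 := by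
    intro h0
    have hnat := relativeSingularHomology.ofAbsolute_comp_map (R := ℂ) (M := ℂ) c
      (OnePoint.mapsTo_collapse_compl_singleton φN.injective ⟨z₀, hz₀G⟩) k
    have h1 : relativeSingularHomology.map ℂ ℂ c
        (OnePoint.mapsTo_collapse_compl_singleton φN.injective ⟨z₀, hz₀G⟩) k
        (relativeSingularHomology.ofAbsolute ℂ ℂ N {z₀}ᶜ k ν.fundamentalClass) = 0 := by
      rw [← ModuleCat.comp_apply, hnat, ModuleCat.comp_apply, h0, map_zero]
    apply hne0
    apply (asIso (relativeSingularHomology.map ℂ ℂ c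
      (OnePoint.mapsTo_collapse_compl_singleton φN.injective ⟨z₀, hz₀G⟩) k)).toLinearEquiv.injective
    rw [map_zero, ← hloc]
    exact h1
  -- a cohomology class of `K⁺` detecting `c_* [N]` (universal coefficients over `ℂ`)
  obtain ⟨ω, hω⟩ : ∃ ω : singularCohomology ℂ ℂ (OnePoint K) k,
      kroneckerPairing ℂ ℂ (OnePoint K) k ω (singularHomology.map ℂ ℂ c k ν.fundamentalClass) ≠ 0 := by
    by_contra hall
    push Not at hall
    apply hpush
    refine (Module.forall_dual_apply_eq_zero_iff ℂ _).1 fun φ ↦ ?_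
    obtain ⟨ω, rfl⟩ := (kroneckerPairing_bijective_of_field ℂ (OnePoint K) k).2 φ
    exact hall ω
  have hcω : singularCohomology.map ℂ ℂ c k ω ≠ 0 := by
    intro h0
    apply hω
    rw [← kroneckerPairing_map, h0, map_zero, LinearMap.zero_apply]
  -- `η = Φ^* ω`
  refine ⟨W₁, hW₁, hTW₁, hfW, singularCohomology.map ℂ ℂ Φc k ω, ?_⟩
  have hres : subsetCochains.restrictMap f hfW =
      fW.comp (⟨Subtype.val, continuous_subtype_val⟩ : C(↥(univ : Set N), N)) := by
    ext z
    rfl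
  rw [hres, singularCohomology.map_comp, ModuleCat.comp_apply, ← ModuleCat.comp_apply _ _ ω,
    ← singularCohomology.map_comp, hcomp]
  have hinj : Function.Injective (singularCohomology.map ℂ ℂ
      ((Homeomorph.Set.univ N : ↥(univ : Set N) ≃ₜ N) : C(↥(univ : Set N), N)) k) :=
    ((forget (ModuleCat ℂ)).mapIso (singularCohomology.mapIso ℂ ℂ (Homeomorph.Set.univ N) k)).toEquiv.injective
  intro h0
  apply hcω
  exact hinj (by rw [map_zero]; exact h0)

end Summit.HodgeConjecture.HodgeConjecture.Theorems

end
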